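import Literature.NumberTheory.GaloisRepresentations.ArtinConductorLocalProofs
import Literature.NumberTheory.GaloisRepresentations.InertiaLiftAbsoluteProofs
import Literature.NumberTheory.GaloisRepresentations.WeilGroupProofs
import HarnessLib

/-!
# The Artin conductor of a Weil–Deligne representation: integrality reduced to the Hasse–Arf
theorem (trunk GalRep, item C10; provefact `WeilDeligneRep.natCast_floor_artinConductor`)

Theorems only.  `ArtinConductor.lean` attaches to a Weil–Deligne representation `r = (ρ, N)` of
the Weil group `W_F` of a non-archimedean local field `F` the real Artin conductor of `ρ`,
`a(ρ) = codim V^{I_F} + ∫₀^∞ codim V^{I^u} du` (`WeilDeligneRep.artinConductor`, with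
`I^u = upperInertia F u`, the preimage in `W_F` of the absolute upper-numbering group `I_F^u`),
and states its integrality as the named fact `WeilDeligneRep.natCast_floor_artinConductor`
[SerreLocalFields1979, Ch. VI §2, Thm 1']: for `V` finite-dimensional over a field `C` of
characteristic `0`, `⌊a(ρ)⌋₊ = a(ρ)`.

The printed source (Serre, *Local Fields*, Ch. VI §2, pp. 99–103): for a finite Galois extension
`L/K` of complete discretely valued fields with separable residue extension, group `G`,
ramification groups `G_i` of orders `g_i`, and a character `χ` of a representation of `G` on `V`,
`f(χ) = Σ_i (g_i/g_0) codim V^{G_i}` (Cor. 1' to Prop. 2) and **Theorem 1'**: "`f(χ)` is a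
non-negative integer for every character `χ` of `G`", proved (p. 103) from Brauer's theorem, the
Corollary to Prop. 4 (integrality of the different exponent) and the Corollary to Prop. 5
("`f(χ) = φ_{K'/K}(c'_χ) + 1`, and this is an integer `≥ 0`" — Herbrand's theorem and "the
theorem of Hasse–Arf (Chap. V, §7), since `G/H` is abelian").  The Weil–Deligne statement
follows because `ρ` is trivial on an open subgroup of `I_F` (`WeilGroup.IsContinuousRep`), hence
`ρ|_{I_F}` is inflated from a representation of the inertia group `G_0` of a finite Galois layer
`E/F` of `F̄`, and by Herbrand's theorem (Ch. IV §3 Prop. 14, Remark 1) the upper-numbering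
integral is Serre's lower-numbering sum: `a(ρ) = f(ρ|_{G_0})` for the totally ramified extension
with group `G_0` (remark after Prop. 1, p. 100).

This file carries that deduction out, exactly parallel to `ArtinConductorLocalProofs` (which does
it for Galois representations `Γ_F → GL(M)` with `ρ|_{I_F}` through a finite quotient), down to the
leaf of the printed theory that the tree still states as a named fact, the **Hasse–Arf theorem**
(`Literature.NumberTheory.GaloisRepresentations.hasseArf`, `ArtinRepresentation.lean`):

* `WeilDeligneRep.inertiaToWeilGroup` — the inclusion `I_F →* W_F` (`I_F ≤ W_F`,
  `absInertia_le_weilSubgroup`), through which `ρ|_{I_F}` is the representation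
  `ρ.comp inertiaToWeilGroup` of the profinite inertia group;
* `WeilDeligneRep.fixedSubmodule_upperInertia_eq` — `V^{I^u} = V^{\{σ ∈ I_F : σ|_E ∈ Gal(E/F)^u\}}`
  for `ρ` trivial on `Gal(F̄/E) ∩ I_F` (Herbrand: `I_F^u ↠ Gal(E/F)^u`,
  `absUpperInertia_map_absRestrictNormalHom_holds`; every characteristic);
* `WeilDeligneRep.artinConductor_eq_artinExponent_inertia` — **`a(ρ) = f(ρ|_{I_F})`** computed
  through `σ ↦ σ|_E` (Serre VI §2 Cor. 1'; Katz's "compatibility between upper and lower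
  numbering"; every characteristic);
* `WeilDeligneRep.exists_isGalois_forall_inertia_eq_one` — the open subgroup of `I_F` on which `ρ`
  is trivial contains `Gal(F̄/E) ∩ I_F` for a finite Galois `E ⊆ F̄` (the Weil topology induces
  the Krull topology on `I_F`, `WeilGroup.exists_isOpen_inter_inertia_eq`; a finite normal layer
  `E'` and its separable part `E = E' ∩ F^{sep}` have the same fixing subgroup,
  `fixingSubgroup_inf_separableClosure`);
* `WeilDeligneRep.exists_natCast_eq_artinConductor_of_artinExponent` — `a(ρ) ∈ ℕ` from Artin's
  theorem `f(τ) ∈ ℕ` for the representations `τ` of the inertia groups `I(𝔓 ∩ E) ≤ Gal(E/F)` of the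
  finite Galois layers (hypothesis `hint`; the surjectivity `I_F ↠ I(𝔓 ∩ E)` is
  `inertia_comap_le_map_absRestrictNormalHom` of `InertiaLiftAbsoluteProofs`, every characteristic);
* `WeilDeligneRep.natCast_floor_artinConductor_of_arith`, `…_of_hasseArf` — **the named fact
  `natCast_floor_artinConductor`** from the degree-one integrality
  (`card_inf_inertia_dvd_finsum_card_inf_ramificationSubgroup 𝒪[F]` at the finite layers, Serre VI
  §2 Cor. to Prop. 5), resp. from the Hasse–Arf theorem alone (`hasseArf` for the Dedekind
  fraction-field triples in the universe of `F`, via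
  `card_inf_inertia_dvd_finsum_card_inf_ramificationSubgroup_of_hasseArf` and
  `exists_natCast_eq_artinExponent_inertia_local_charZero`: Brauer's theorem and the different
  exponent are proved in the tree, and the coefficient field `C` has characteristic `0`, so no
  finite-field input is needed).

Everything here holds for `F` of any characteristic.  What is *not* proved is the Hasse–Arf theorem
itself (Serre V §7): `natCast_floor_artinConductor_holds` is `natCast_floor_artinConductor_of_hasseArf`
fed with a (universe-polymorphic) discharge `hasseArf_holds`, not yet in the tree.

## References

* J.-P. Serre, *Local Fields*, GTM 67 (1979), Ch. IV §3 Prop. 14, Remark 1 and Theorem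
  (Hasse–Arf, p. 76); Ch. VI §2 Props. 1–5, Cor. 1' to Prop. 2, Thm 1' and its proof
  (pp. 99–103). [SerreLocalFields1979]
* N. M. Katz, *Gauss Sums, Kloosterman Sums, and Monodromy Groups* (1988), Ch. 1, 1.6 and
  Prop. 1.9 (proof). [Katz1988]
* J. Tate, *Number theoretic background* (Corvallis 1979), (1.4.1), (4.1.2), (4.2.4).
  [TateCorvallis1979]
* P. Deligne, *Les constantes des équations fonctionnelles des fonctions L* (Antwerp II, 1973),
  §4.5, §8.12. [DeligneAntwerpII1973]
-/

noncomputable section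

open scoped Valued
open Field IsDedekindDomain MeasureTheory Module ValuativeRel
open Literature.NumberTheory.GaloisRepresentations.IsNonarchimedeanLocalField

namespace Literature.NumberTheory.GaloisRepresentations

universe u v w

namespace WeilDeligneRep

open WeilGroup

variable {F : Type u} [Field F] [ValuativeRel F] [TopologicalSpace F] [IsNonarchimedeanLocalField F]

/-! ### The inertia group inside the Weil group -/

section Inclusion

variable (F) in
/-- The inclusion `I_F →* W_F` of the absolute inertia group
`I_F = absInertia F = I(𝔓) ≤ Γ_F` (`𝔓 = absMaximalIdeal F`; written as Mathlib's `Ideal.inertia`,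
the form in which `absInertia` unfolds and in which the finite-level statements of
`ArtinConductorIntegrality` are phrased) into the Weil group: every element of `I_F` is a Frobenius
power of exponent `0` (`isFrobPow_zero_iff_mem_absInertia`; `I_F ≤ W_F`,
`absInertia_le_weilSubgroup`).  Its image is `WeilGroup.inertia F`
(`inertiaToWeilGroup_mem_inertia`, `eq_inertiaToWeilGroup_of_mem_inertia`).
Ref: Tate, *Number theoretic background* (Corvallis 1979), (1.4.1). [folklore] -/
def inertiaToWeilGroup : ↥((absMaximalIdeal F).inertia (absoluteGaloisGroup F)) →* WeilGroup F where
  toFun σ := WeilGroup.mk (σ : absoluteGaloisGroup F)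
    ⟨0, isFrobPow_zero_iff_mem_absInertia.mpr σ.2⟩
  map_one' := toAbsGalois_injective rfl
  map_mul' _ _ := toAbsGalois_injective rfl

/-- `toAbsGalois (inertiaToWeilGroup σ) = σ`. [folklore] -/
@[simp] theorem toAbsGalois_inertiaToWeilGroup
    (σ : (absMaximalIdeal F).inertia (absoluteGaloisGroup F)) :
    toAbsGalois F (inertiaToWeilGroup F σ) = σ :=
  rfl

/-- The inclusion `I_F → W_F` lands in `WeilGroup.inertia F`. [folklore] -/
theorem inertiaToWeilGroup_mem_inertia (σ : (absMaximalIdeal F).inertia (absoluteGaloisGroup F)) :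
    inertiaToWeilGroup F σ ∈ inertia F :=
  mem_inertia_iff.mpr σ.2

/-- Every `w ∈ WeilGroup.inertia F` is the image of `⟨toAbsGalois w, _⟩ ∈ I_F`. [folklore] -/
theorem eq_inertiaToWeilGroup_of_mem_inertia {w : WeilGroup F} (hw : w ∈ inertia F) :
    w = inertiaToWeilGroup F ⟨toAbsGalois F w, mem_inertia_iff.mp hw⟩ :=
  toAbsGalois_injective rfl

end Inclusion

/-! ### `a(ρ) = f(ρ|_{I_F})` for a Weil–Deligne representation inflated on inertia -/

section Inertia

variable {C : Type v} [Field C] [CharZero C] {V : Type w} [AddCommGroup V] [Module C V]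

/-- **`V^{I^u} = V^{\{σ ∈ I_F : σ|_E ∈ Gal(E/F)^u\}}`** (`u ≥ 0`) for the Weil-group representation
`ρ` of a Weil–Deligne representation trivial on `Gal(F̄/E) ∩ I_F`, `E/F` finite Galois inside `F̄`
(Weil-group form of `GaloisRep.fixedSubmodule_absUpperInertia_eq`, every characteristic): `⊇`
because `I_F^u ≤ I_F` (`absUpperInertia_le_absInertia_holds`) restricts into `Gal(E/F)^u`; `⊆` by
Herbrand's theorem for `F̄/E/F`, `I_F^u ↠ Gal(E/F)^u` (`absUpperInertia_map_absRestrictNormalHom_holds`).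
Ref: Serre, *Local Fields*, Ch. IV §3, Prop. 14 and Remark 1; Deligne, Antwerp II (1973), §4.5.
[cite: SerreLocalFields1979, Ch. IV §3 Prop. 14 and Remark 1] -/
theorem fixedSubmodule_upperInertia_eq
    (E : IntermediateField F (AlgebraicClosure F)) [FiniteDimensional F E] [IsGalois F E]
    (r : WeilDeligneRep F C V)
    (hE : ∀ w ∈ inertia F, absRestrictNormalHom E (toAbsGalois F w) = 1 → r.ρ w = 1)
    {u : ℝ} (hu : 0 ≤ u) :
    r.fixedSubmodule (upperInertia F u) =
      Representation.fixedSubmodule (r.ρ.comp (inertiaToWeilGroup F))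
        ((upperRamificationSubgroup ((absMaximalIdeal F).comap (E.integralClosureToAbsIntegers 𝒪[F]))
          (E ≃ₐ[F] E) u).comap ((absRestrictNormalHom E).comp
            ((absMaximalIdeal F).inertia (absoluteGaloisGroup F)).subtype)) := by
  have hle : absUpperInertia F u ≤ (absMaximalIdeal F).inertia (absoluteGaloisGroup F) :=
    absUpperInertia_le_absInertia_holds F u
  ext x
  rw [mem_fixedSubmodule, Representation.mem_fixedSubmodule]
  refine ⟨fun hx σ hσ => ?_, fun hx w hw => ?_⟩
  · rw [Subgroup.mem_comap, MonoidHom.comp_apply, Subgroup.subtype_apply,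
      ← absUpperInertia_map_absRestrictNormalHom_holds F E u hu] at hσ
    obtain ⟨γ, hγ, hγσ⟩ := hσ
    -- `γ⁻¹ σ ∈ Gal(F̄/E) ∩ I_F`, so `ρ` agrees on `γ` and `σ`
    have hn : r.ρ (inertiaToWeilGroup F (⟨γ, hle hγ⟩⁻¹ * σ)) = 1 := by
      refine hE _ (inertiaToWeilGroup_mem_inertia _) ?_
      rw [toAbsGalois_inertiaToWeilGroup, Subgroup.coe_mul, Subgroup.coe_inv, map_mul, map_inv, hγσ,
        inv_mul_cancel]
    change r.ρ (inertiaToWeilGroup F σ) x = x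
    have h1 : r.ρ (inertiaToWeilGroup F σ) = r.ρ (inertiaToWeilGroup F ⟨γ, hle hγ⟩) := by
      conv_lhs =>
        rw [← mul_inv_cancel_left (⟨γ, hle hγ⟩ : (absMaximalIdeal F).inertia (absoluteGaloisGroup F))
          σ, map_mul, map_mul, hn, mul_one]
    rw [h1]
    exact hx _ (Subgroup.mem_comap.mpr hγ)
  · have hγ : toAbsGalois F w ∈ absUpperInertia F u := Subgroup.mem_comap.mp hw
    have hwI : w ∈ inertia F := mem_inertia_iff.mpr (hle hγ)
    have hγu : absRestrictNormalHom E (toAbsGalois F w) ∈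
        upperRamificationSubgroup ((absMaximalIdeal F).comap (E.integralClosureToAbsIntegers 𝒪[F]))
          (E ≃ₐ[F] E) u :=
      (mem_absUpperRamificationSubgroup_iff.mp hγ) E
    rw [eq_inertiaToWeilGroup_of_mem_inertia hwI]
    exact hx ⟨toAbsGalois F w, mem_inertia_iff.mp hwI⟩ (Subgroup.mem_comap.mpr hγu)

/-- `V^{I_F}` (fixed vectors of `WeilGroup.inertia F`) is the fixed space of the whole profinite
inertia group under `ρ|_{I_F} = ρ.comp inertiaToWeilGroup`. [folklore] -/
theorem fixedSubmodule_inertia_eq (r : WeilDeligneRep F C V) :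
    r.fixedSubmodule (inertia F) = Representation.fixedSubmodule (r.ρ.comp (inertiaToWeilGroup F)) ⊤ := by
  ext x
  rw [mem_fixedSubmodule, Representation.mem_fixedSubmodule]
  refine ⟨fun hx σ _ => hx _ (inertiaToWeilGroup_mem_inertia σ), fun hx w hw => ?_⟩
  rw [eq_inertiaToWeilGroup_of_mem_inertia hw]
  exact hx _ (Subgroup.mem_top _)

/-- **`a(ρ) = f(ρ|_{I_F})` for the Weil-group representation of a Weil–Deligne representation
inflated on inertia** (Weil-group form of `GaloisRep.localArtinConductorReal_eq_artinExponent_inertia`).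
Let `F` be a non-archimedean local field (any characteristic), `E/F` a finite Galois subextension of
`F̄` with `G = Gal(E/F)` and ramification groups `G_i` at `𝔓 ∩ E` (`𝔓 = absMaximalIdeal F`), and
`r = (ρ, N)` a Weil–Deligne representation with `ρ` trivial on `Gal(F̄/E) ∩ I_F`.  Then
`a(ρ) = codim V^{I_F} + ∫₀^∞ codim V^{I^u} du` (`WeilDeligneRep.artinConductor`) is Serre's
exponent of `ρ|_{I_F}` computed through `σ ↦ σ|_E`:
`Σ_{i ≥ 0} (g_i/g_0) codim V^{\{σ ∈ I_F : σ|_E ∈ G_i\}}` (`artinExponent`): the integrand is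
`c_{⌈ψ u⌉}` on `(0, ∞)` (`fixedSubmodule_upperInertia_eq`, `G^u = G_{⌈ψ u⌉₊}`), the `c_i` vanish
for `i ≫ 0` (`ramificationSubgroup_comap_eventually_eq_bot`), the integral is
`Σ_{i ≥ 1} (g_i/g_0) c_i` (`integral_Ioi_comp_ceil_herbrandPsi`) and the tame term is `c_0`
(`fixedSubmodule_inertia_eq`, `GaloisRep.comap_inertia_comp_subtype_eq_top`).
Ref: Serre, *Local Fields*, Ch. VI §2, Cor. 1' to Prop. 2 and Exercise 1; Ch. IV §3, Prop. 14 and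
Remark 1; Katz (1988), Ch. 1, 1.6 and proof of Prop. 1.9; Deligne, Antwerp II (1973), §4.5.
[cite: SerreLocalFields1979, Ch. VI §2 Cor. 1' to Prop. 2] [cite: Katz1988, Ch. 1, Prop. 1.9 (proof)] -/
theorem artinConductor_eq_artinExponent_inertia
    (E : IntermediateField F (AlgebraicClosure F)) [FiniteDimensional F E] [IsGalois F E]
    (r : WeilDeligneRep F C V)
    (hE : ∀ w ∈ inertia F, absRestrictNormalHom E (toAbsGalois F w) = 1 → r.ρ w = 1) :
    r.artinConductor =
      artinExponent ((absMaximalIdeal F).comap (E.integralClosureToAbsIntegers 𝒪[F])) (E ≃ₐ[F] E)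
        ((absRestrictNormalHom E).comp ((absMaximalIdeal F).inertia (absoluteGaloisGroup F)).subtype)
        (r.ρ.comp (inertiaToWeilGroup F)) := by
  classical
  haveI : (absMaximalIdeal F).IsMaximal := absMaximalIdeal_isMaximal_holds F
  -- Step 0: `G_i = 1` for `i ≥ N`
  haveI : Algebra.IsSeparable F E := IsGalois.to_isSeparable
  obtain ⟨N, hN⟩ := ramificationSubgroup_comap_eventually_eq_bot 𝒪[F] (absMaximalIdeal F) E
  -- notation
  set 𝔓E := (absMaximalIdeal F).comap (E.integralClosureToAbsIntegers 𝒪[F]) with h𝔓E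
  set I := (absMaximalIdeal F).inertia (absoluteGaloisGroup F) with hI
  set j : I →* (E ≃ₐ[F] E) := (absRestrictNormalHom E).comp I.subtype with hj
  set τ : Representation C I V := r.ρ.comp (inertiaToWeilGroup F) with hτ
  -- the coefficients `c i = codim V^{j⁻¹ G_i}`
  set c : ℕ → ℝ := fun i =>
    (Representation.codimFixed τ ((𝔓E.ramificationSubgroup (E ≃ₐ[F] E) i).comap j) : ℝ) with hc
  -- Step 1: eventual vanishing of `c`
  have hcN : ∀ i, N < i → c i = 0 := by
    intro i hi
    simp only [hc, Nat.cast_eq_zero, Representation.codimFixed]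
    have htop : Representation.fixedSubmodule τ
        ((𝔓E.ramificationSubgroup (E ≃ₐ[F] E) i).comap j) = ⊤ := by
      rw [eq_top_iff]
      intro x _
      rw [Representation.mem_fixedSubmodule]
      intro σ hσ
      rw [hN i hi.le, Subgroup.mem_comap, Subgroup.mem_bot] at hσ
      change r.ρ (inertiaToWeilGroup F σ) x = x
      rw [hE _ (inertiaToWeilGroup_mem_inertia σ) hσ, Module.End.one_apply]
    rw [htop]
    haveI : Subsingleton (V ⧸ (⊤ : Submodule C V)) := Submodule.Quotient.subsingleton_iff.mpr rfl
    exact finrank_zero_of_subsingleton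
  -- Step 2: the Swan conductor
  have hswan : r.swanConductor =
      ∑ i ∈ Finset.range N, ((Nat.card (𝔓E.ramificationSubgroup (E ≃ₐ[F] E) (i + 1)) : ℝ) /
        Nat.card (𝔓E.ramificationSubgroup (E ≃ₐ[F] E) 0)) * c (i + 1) := by
    rw [swanConductor, ← integral_Ioi_comp_ceil_herbrandPsi 𝔓E (E ≃ₐ[F] E) c hcN]
    refine setIntegral_congr_fun measurableSet_Ioi fun u hu => ?_
    simp only [hc]
    rw [codimFixed, Representation.codimFixed, fixedSubmodule_upperInertia_eq E r hE (le_of_lt hu)]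
    rfl
  -- Step 3: the tame term
  have htame : (r.codimFixed (inertia F) : ℝ) = c 0 := by
    simp only [hc]
    rw [Ideal.ramificationSubgroup_zero, GaloisRep.comap_inertia_comp_subtype_eq_top, codimFixed,
      Representation.codimFixed, fixedSubmodule_inertia_eq]
  -- Step 4: assemble
  rw [artinConductor, hswan, htame, artinExponent_def]
  have hsupp : (Function.support fun i : ℕ =>
      ((Nat.card (𝔓E.ramificationSubgroup (E ≃ₐ[F] E) i) : ℝ) /
        Nat.card (𝔓E.ramificationSubgroup (E ≃ₐ[F] E) 0)) * c i) ⊆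
      ((Finset.range (N + 1) : Finset ℕ) : Set ℕ) := by
    intro i hi
    rw [Finset.coe_range, Set.mem_Iio]
    by_contra h
    refine hi ?_
    change _ * c i = 0
    rw [hcN i (by omega), mul_zero]
  rw [finsum_eq_sum_of_support_subset _ hsupp, Finset.sum_range_succ', div_self
    (Nat.cast_ne_zero.mpr Nat.card_pos.ne'), one_mul, add_comm]

end Inertia

/-! ### The finite Galois layer and the reduction to Artin's theorem -/

section Assembly

variable {C : Type v} [Field C] [CharZero C] {V : Type w} [AddCommGroup V] [Module C V]

/-- **The open kernel of `ρ` on inertia contains `Gal(F̄/E) ∩ I_F` for a finite Galois layer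
`E/F`** (every characteristic).  For a Weil–Deligne representation `r = (ρ, N)`: `ρ` is trivial on
an open subgroup `U ≤ I_F` of `W_F` (`WeilDeligneRep.isContinuous`); the Weil topology induces the
Krull topology on `I_F`, so `U = I_F ∩ V` for a Krull-open `V ∋ 1`
(`WeilGroup.exists_isOpen_inter_inertia_eq`); `V ⊇ Gal(F̄/E')` for a finite normal `E' ⊆ F̄`
(`krullTopology_mem_nhds_one_iff_of_normal`), and `E = E' ∩ F^{sep}` is finite Galois with the same
fixing subgroup, `Gal(F̄/E) = Gal(F̄/E')` (`fixingSubgroup_inf_separableClosure`: `F̄/F^{sep}` is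
purely inseparable; in characteristic `0`, `E = E'`).
Ref: Tate, *Number theoretic background* (Corvallis 1979), (1.4.1), (4.1.2); Deligne, Antwerp II
(1973), §4.5, §8.12 (`ρ(I)` finite). [cite: TateCorvallis1979, (4.1.2)] -/
theorem exists_isGalois_forall_inertia_eq_one (r : WeilDeligneRep F C V) :
    ∃ (E : IntermediateField F (AlgebraicClosure F)) (_ : FiniteDimensional F E) (_ : IsGalois F E),
      ∀ w ∈ inertia F, absRestrictNormalHom E (toAbsGalois F w) = 1 → r.ρ w = 1 := by
  obtain ⟨U, -, hU, hUker⟩ := r.isContinuous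
  obtain ⟨W, hW, hUW⟩ := exists_isOpen_inter_inertia_eq hU
  -- `1 ∈ U`, so `1 ∈ W` and `W` is a Krull neighbourhood of `1`
  have h1U : (1 : WeilGroup F) ∈ (U : Set (WeilGroup F)) ∩ (inertia F : Set (WeilGroup F)) :=
    ⟨U.one_mem, (inertia F).one_mem⟩
  rw [hUW] at h1U
  have h1W : (1 : absoluteGaloisGroup F) ∈ W := by simpa only [map_one] using h1U.2
  obtain ⟨E', hEfd, hEn, hE'⟩ :=
    (krullTopology_mem_nhds_one_iff_of_normal F (AlgebraicClosure F) _).mp (hW.mem_nhds h1W)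
  haveI := hEfd
  haveI := hEn
  -- shrink to the separable part `E = E' ∩ F^{sep}`: finite Galois, same fixing subgroup
  haveI hfinE : FiniteDimensional F (E' ⊓ separableClosure F (AlgebraicClosure F) :
      IntermediateField F (AlgebraicClosure F)) :=
    FiniteDimensional.of_injective
      (IntermediateField.inclusion
        (inf_le_left : E' ⊓ separableClosure F (AlgebraicClosure F) ≤ E')).toLinearMap
      (IntermediateField.inclusion_injective
        (inf_le_left : E' ⊓ separableClosure F (AlgebraicClosure F) ≤ E'))
  haveI hsepE : Algebra.IsSeparable F (E' ⊓ separableClosure F (AlgebraicClosure F) :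
      IntermediateField F (AlgebraicClosure F)) :=
    (le_separableClosure_iff F (AlgebraicClosure F) _).mp inf_le_right
  haveI hnormE : Normal F (E' ⊓ separableClosure F (AlgebraicClosure F) :
      IntermediateField F (AlgebraicClosure F)) := inferInstance
  haveI hgalE : IsGalois F (E' ⊓ separableClosure F (AlgebraicClosure F) :
      IntermediateField F (AlgebraicClosure F)) := ⟨⟩
  refine ⟨E' ⊓ separableClosure F (AlgebraicClosure F), hfinE, hgalE, fun w hwI hw => hUker _ ?_⟩
  -- `w ∈ I_F` maps into `Gal(F̄/E) = Gal(F̄/E') ⊆ W`, hence lies in `U ∩ I_F = I_F ∩ W`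
  have hmem : absoluteGaloisGroup.toAlgEquiv F (toAbsGalois F w) ∈ E'.fixingSubgroup := by
    rw [← fixingSubgroup_inf_separableClosure F E', ← IntermediateField.restrictNormalHom_ker,
      MonoidHom.mem_ker]
    exact hw
  have hwU : w ∈ (U : Set (WeilGroup F)) ∩ (inertia F : Set (WeilGroup F)) := by
    rw [hUW]
    exact ⟨hwI, hE' hmem⟩
  exact hwU.1

/-- **Integrality of the Artin conductor of a Weil–Deligne representation, from Artin's theorem at
the finite layers** (Weil-group form of
`GaloisRep.exists_natCast_eq_localArtinConductorReal_of_artinExponent`, every characteristic).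
Choose a finite Galois `E/F` inside `F̄` with `ρ` trivial on `Gal(F̄/E) ∩ I_F`
(`exists_isGalois_forall_inertia_eq_one`); then `a(ρ) = f(ρ|_{I_F})`
(`artinConductor_eq_artinExponent_inertia`), `ρ|_{I_F}` is inflated from a representation `τ₀` of
the inertia group `I(𝔓 ∩ E) ≤ Gal(E/F)` on `V` (`I_F ↠ I(𝔓 ∩ E)`,
`inertia_comap_le_map_absRestrictNormalHom` of `InertiaLiftAbsoluteProofs`, every characteristic;
`exists_artinExponent_eq_of_ker_le`), and `f(τ₀) ∈ ℕ` by the hypothesis `hint` (Artin's theorem,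
Serre VI §2 Thm 1' with Cor. 1', for the inertia groups of the finite Galois layers of `F̄/F` and
representations on `V`).
Ref: Serre, *Local Fields*, Ch. VI §2, Thm 1', Cor. 1', Prop. 1 and Cor. to Prop. 3; Ch. I §7,
Prop. 22 (b); Katz (1988), Ch. 1, Prop. 1.9 (proof).
[cite: SerreLocalFields1979, Ch. VI §2, Thm 1' and Cor. 1'] -/
theorem exists_natCast_eq_artinConductor_of_artinExponent
    (hint : ∀ (E : IntermediateField F (AlgebraicClosure F)) [FiniteDimensional F E] [IsGalois F E]
      (τ : Representation C (((absMaximalIdeal F).comap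
        (E.integralClosureToAbsIntegers 𝒪[F])).inertia (E ≃ₐ[F] E)) V),
      ∃ n : ℕ, (n : ℝ) = artinExponent ((absMaximalIdeal F).comap
        (E.integralClosureToAbsIntegers 𝒪[F])) (E ≃ₐ[F] E)
        (((absMaximalIdeal F).comap (E.integralClosureToAbsIntegers 𝒪[F])).inertia
          (E ≃ₐ[F] E)).subtype τ)
    (r : WeilDeligneRep F C V) :
    ∃ n : ℕ, (n : ℝ) = r.artinConductor := by
  haveI : (absMaximalIdeal F).IsMaximal := absMaximalIdeal_isMaximal_holds F
  obtain ⟨E, hEfd, hEg, hEker⟩ := r.exists_isGalois_forall_inertia_eq_one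
  rw [artinConductor_eq_artinExponent_inertia E r hEker]
  -- `ρ|_{I_F}` is inflated from a representation `τ₀` of `I(𝔓 ∩ E)`
  obtain ⟨τ₀, hτ₀⟩ := exists_artinExponent_eq_of_ker_le
    ((absRestrictNormalHom E).comp ((absMaximalIdeal F).inertia (absoluteGaloisGroup F)).subtype)
    (fun g hg => by
      obtain ⟨σ, hσ, rfl⟩ := inertia_comap_le_map_absRestrictNormalHom (absMaximalIdeal F) E hg
      exact ⟨⟨σ, hσ⟩, rfl⟩)
    (r.ρ.comp (inertiaToWeilGroup F))
    (fun σ hσ => by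
      rw [MonoidHom.mem_ker, MonoidHom.comp_apply, Subgroup.subtype_apply] at hσ
      rw [MonoidHom.mem_ker, MonoidHom.comp_apply]
      exact hEker _ (inertiaToWeilGroup_mem_inertia σ) hσ)
  rw [hτ₀]
  exact hint E τ₀

/-- `natCast_floor_artinConductor` from Artin's theorem at the finite layers (`hint` as in
`exists_natCast_eq_artinConductor_of_artinExponent`; every characteristic): `a(ρ) = n ∈ ℕ` and
`⌊n⌋₊ = n`. [cite: SerreLocalFields1979, Ch. VI §2, Thm 1' and Cor. 1'] -/
theorem natCast_floor_artinConductor_of_artinExponent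
    (hint : ∀ [FiniteDimensional C V] (E : IntermediateField F (AlgebraicClosure F))
      [FiniteDimensional F E] [IsGalois F E]
      (τ : Representation C (((absMaximalIdeal F).comap
        (E.integralClosureToAbsIntegers 𝒪[F])).inertia (E ≃ₐ[F] E)) V),
      ∃ n : ℕ, (n : ℝ) = artinExponent ((absMaximalIdeal F).comap
        (E.integralClosureToAbsIntegers 𝒪[F])) (E ≃ₐ[F] E)
        (((absMaximalIdeal F).comap (E.integralClosureToAbsIntegers 𝒪[F])).inertia
          (E ≃ₐ[F] E)).subtype τ) :
    natCast_floor_artinConductor (F := F) (C := C) (V := V) := by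
  intro _ r
  obtain ⟨n, hn⟩ := exists_natCast_eq_artinConductor_of_artinExponent (fun E _ _ τ => hint E τ) r
  rw [← hn, Nat.floor_natCast]

/-- **`natCast_floor_artinConductor` from the degree-one integrality** (Serre VI §2 Cor. to
Prop. 5 — Herbrand + Hasse–Arf — as the named fact
`card_inf_inertia_dvd_finsum_card_inf_ramificationSubgroup 𝒪[F]` for the finite layers `E` of
`F̄/F`; every characteristic): Artin's theorem for the inertia groups of the layers is then the
tree's `exists_natCast_eq_artinExponent_inertia_local_charZero` (Brauer's theorem and the
integrality of the different exponent being proved in the tree; `C` has characteristic `0`).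
Ref: Serre, *Local Fields*, Ch. VI §2, Thm 1' (proof, p. 103).
[cite: SerreLocalFields1979, Ch. VI §2, Thm 1' (proof)] -/
theorem natCast_floor_artinConductor_of_arith
    (hHA : ∀ E : IntermediateField F (AlgebraicClosure F),
      card_inf_inertia_dvd_finsum_card_inf_ramificationSubgroup 𝒪[F] (K := F) (L := E)) :
    natCast_floor_artinConductor (F := F) (C := C) (V := V) :=
  natCast_floor_artinConductor_of_artinExponent fun E _ _ τ =>
    exists_natCast_eq_artinExponent_inertia_local_charZero E (hHA E) τ

/-- **`natCast_floor_artinConductor` from the Hasse–Arf theorem alone.**  For a non-archimedean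
local field `F` (any characteristic) and a finite-dimensional Weil–Deligne representation
`r = (ρ, N)` over a field `C` of characteristic `0`, `⌊a(ρ)⌋₊ = a(ρ)`, granted the Hasse–Arf
theorem (`hasseArf`, Serre IV §3 / V §7, for the finite Galois extensions of Dedekind fraction
fields in the universe of `F`, as a universe-polymorphic discharge `hasseArf_holds` would provide
it): the degree-one integrality is
`card_inf_inertia_dvd_finsum_card_inf_ramificationSubgroup_of_hasseArf`.  This is Serre's Theorem 1'
with its printed proof, transported to the Weil group by Herbrand's theorem; feeding a discharge of
`hasseArf` here yields `natCast_floor_artinConductor_holds`.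
Ref: Serre, *Local Fields*, Ch. VI §2, Thm 1' and its proof (p. 103); Ch. IV §3, Theorem
(Hasse–Arf). [cite: SerreLocalFields1979, Ch. VI §2, Thm 1']
[cite: SerreLocalFields1979, Ch. IV §3, Theorem (Hasse–Arf)] -/
theorem natCast_floor_artinConductor_of_hasseArf
    (hHA : ∀ (R' K' L' : Type u) [CommRing R'] [Field K'] [Field L'] [Algebra R' K']
      [Algebra R' L'] [Algebra K' L'] [IsScalarTower R' K' L'], hasseArf R' (K := K') (L := L')) :
    natCast_floor_artinConductor (F := F) (C := C) (V := V) :=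
  natCast_floor_artinConductor_of_arith fun _ =>
    card_inf_inertia_dvd_finsum_card_inf_ramificationSubgroup_of_hasseArf hHA

end Assembly

end WeilDeligneRep

end Literature.NumberTheory.GaloisRepresentations
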